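import Summits.RiemannHypothesis.RiemannHypothesis.Theorems.DBNDefs
import Mathlib.Analysis.Calculus.MeanValue
import Mathlib.Analysis.SpecialFunctions.Log.Deriv
import HarnessLib

/-!
# RiemannHypothesis / DBN — T3 `ClassFloorExitTime`: the idealised class floor as an ODE comparison

RH-FREE calculus (THEORY-R2 §5 of the `pub-dbn` cell; referee GAP-note DBN-n1 asked for the
probe-class ceiling to be theorem-shaped).  Proved here, sorry-free, standard axioms:

* `ClassPotentialDeriv_holds` (T3s): `G'(y) = y/(1 + ℓy/4)` for the potential
  `G(y) = (4/ℓ)(y - (4/ℓ) log(1 + ℓy/4))`, `ℓ > 0`, `y ≥ 0`;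
* `ClassFloorExitTime_holds` (T3): an envelope `Y`, continuous on `[0,T]`, positive on `[0,T)`,
  `Y 0 = Y₀ > 0`, `Y T = 0`, with derivative never below `-(1/Y + ℓ/4)` on `(0,T)`, has
  `T ≥ classFloor ℓ Y₀ = G(Y₀)`: the function `t ↦ G(Y t) + t` is monotone on `[0,T]`
  (`monotoneOn_of_deriv_nonneg`), and `G(0) = 0`.

The number `classFloor 26.8918 0.98846 = 0.1020…` quoted by the theory memos is a MODEL value and is
not asserted anywhere in the tree.  `--supports stmt-RiemannHypothesis-0274`; nothing here bears on
the truth of RH.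
-/

noncomputable section

-- D-0017: `Summit.<S>.<S>.…` is the designed namespace of a single-problem summit.
set_option linter.dupNamespace false

open scoped Real
open Set

namespace Summit.RiemannHypothesis.RiemannHypothesis.Theorems.DbnTheory

/-! ## T3: the class-floor exit time (ODE comparison) -/

/-- **`ClassPotentialDeriv`** (T3s): `G'(y) = y/(1 + ℓy/4)` for `ℓ > 0`, `y ≥ 0`. [folklore] -/
theorem ClassPotentialDeriv_holds : ClassPotentialDeriv := by
  intro ℓ y hℓ hy
  have hpos : 0 < 1 + ℓ * y / 4 := by positivity
  have h1 : HasDerivAt (fun y : ℝ => 1 + ℓ * y / 4) (ℓ / 4) y := by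
    have h := (((hasDerivAt_id' y).const_mul ℓ).div_const 4).const_add 1
    simpa using h
  have h2 : HasDerivAt (fun y : ℝ => Real.log (1 + ℓ * y / 4)) ((ℓ / 4) / (1 + ℓ * y / 4)) y :=
    h1.log hpos.ne'
  have h3 : HasDerivAt (classPotential ℓ) ((4 / ℓ) * (1 - (4 / ℓ) * ((ℓ / 4) / (1 + ℓ * y / 4)))) y := by
    show HasDerivAt (fun y => (4 / ℓ) * (y - (4 / ℓ) * Real.log (1 + ℓ * y / 4))) _ y
    exact ((hasDerivAt_id' y).sub (h2.const_mul (4 / ℓ))).const_mul (4 / ℓ)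
  convert h3 using 1
  have hℓ0 : ℓ ≠ 0 := hℓ.ne'
  have hp0 : 1 + ℓ * y / 4 ≠ 0 := hpos.ne'
  field_simp
  ring

/-- **`ClassFloorExitTime`** (T3, THEORY-R2 §5): an envelope descending no faster than the
idealised class rate `1/Y + ℓ/4` from `Y₀` cannot vanish before `classFloor ℓ Y₀`.  Proof:
`t ↦ G(Y t) + t` is continuous on `[0,T]` with derivative `G'(Y)·Y' + 1 ≥ 0` on `(0,T)`, hence
monotone; `G(Y₀) = G(Y 0) + 0 ≤ G(Y T) + T = G(0) + T = T`. [folklore] -/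
theorem ClassFloorExitTime_holds : ClassFloorExitTime := by
  intro ℓ Y₀ T Y hℓ hY₀ hT hYc hY0 hYT hpos hderiv
  have hnonneg : ∀ t ∈ Icc 0 T, 0 ≤ Y t := by
    intro t ht
    rcases eq_or_lt_of_le ht.2 with h | h
    · rw [h, hYT]
    · exact (hpos t ⟨ht.1, h⟩).le
  -- the Lyapunov function `g t = G(Y t) + t`
  have hg_cont : ContinuousOn (fun t => classPotential ℓ (Y t) + t) (Icc 0 T) := by
    unfold classPotential
    refine ContinuousOn.add (continuousOn_const.mul (hYc.sub (continuousOn_const.mul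
      (ContinuousOn.log (continuousOn_const.add ((continuousOn_const.mul hYc).div_const 4))
        fun t ht => ?_)))) continuousOn_id
    have := hnonneg t ht
    positivity
  have hg_diff : ∀ t ∈ Ioo 0 T, ∃ g' : ℝ,
      HasDerivAt (fun t => classPotential ℓ (Y t) + t) g' t ∧ 0 ≤ g' := by
    intro t ht
    obtain ⟨d, hd, hge⟩ := hderiv t ht
    have hYt : 0 < Y t := hpos t ⟨ht.1.le, ht.2⟩
    have hq : 0 ≤ Y t / (1 + ℓ * Y t / 4) := by positivity
    refine ⟨Y t / (1 + ℓ * Y t / 4) * d + 1, ?_, ?_⟩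
    · exact ((ClassPotentialDeriv_holds ℓ (Y t) hℓ hYt.le).comp t hd).add (hasDerivAt_id' t)
    · have h1 := mul_le_mul_of_nonneg_left hge hq
      have h2 : Y t / (1 + ℓ * Y t / 4) * (-(1 / Y t + ℓ / 4)) = -1 := by
        have hYt0 : Y t ≠ 0 := hYt.ne'
        have hp0 : 1 + ℓ * Y t / 4 ≠ 0 := by positivity
        field_simp
      linarith
  have hmono : MonotoneOn (fun t => classPotential ℓ (Y t) + t) (Icc 0 T) := by
    refine monotoneOn_of_deriv_nonneg (convex_Icc 0 T) hg_cont ?_ ?_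
    · rw [interior_Icc]
      intro t ht
      obtain ⟨g', hg', _⟩ := hg_diff t ht
      exact hg'.differentiableAt.differentiableWithinAt
    · rw [interior_Icc]
      intro t ht
      obtain ⟨g', hg', hnn⟩ := hg_diff t ht
      rw [hg'.deriv]
      exact hnn
  have h := hmono (left_mem_Icc.mpr hT.le) (right_mem_Icc.mpr hT.le) hT.le
  simp only [hY0, hYT, add_zero] at h
  rw [classFloor_eq_classPotential]
  have h0 : classPotential ℓ 0 = 0 := by simp [classPotential]
  linarith

end Summit.RiemannHypothesis.RiemannHypothesis.Theorems.DbnTheory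

end
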